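import Mathlib
import HarnessLib
import Literature.Geometry.DiscreteGeometry.BondGraph
import Literature.Geometry.DiscreteGeometry.KissingPatterns
import Summits.AtomisticToContinuum.Crystallization.Theorems.PricedLinkCensusSoftLayerPropagationBasics
import Summits.AtomisticToContinuum.Crystallization.Theorems.PricedLinkCensusSoftLayerPropagationStubDevelopHO
import Summits.AtomisticToContinuum.Crystallization.Theorems.PricedLinkCensusSoftLayerPropagationStubMetricOcta
import Summits.AtomisticToContinuum.Crystallization.Theorems.PricedLinkCensusSoftLayerPropagationStubMetricBipyramid
import Summits.AtomisticToContinuum.Crystallization.Theorems.PricedLinkCensusSoftLayerPropagationStubMetricScaled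
import Summits.AtomisticToContinuum.Crystallization.Theorems.PricedLinkCensusSoftLayerPropagationStubShadowTransition
import Summits.AtomisticToContinuum.Crystallization.Theorems.PricedLinkCensusSoftLayerPropagationHXApex
import Summits.AtomisticToContinuum.Crystallization.Theorems.PricedLinkCensusSoftLayerPropagationHXSite
import Summits.AtomisticToContinuum.Crystallization.Theorems.PricedLinkCensusSoftLayerPropagationHXPattern
import Summits.AtomisticToContinuum.Crystallization.Theorems.PricedLinkCensusSoftLayerPropagationStubChartAssembly
import Summits.AtomisticToContinuum.Crystallization.Theorems.PricedLinkCensusSoftLayerPropagationH1RLabTools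
import Summits.AtomisticToContinuum.Crystallization.Theorems.PricedLinkCensusSoftLayerPropagationH1RDispatch

/-!
# The metric ordered-caps lemma (crux `SoftLayerPropagation`, line `Sketch`, registered stub `develop_H1R`)

Route `PricedLinkCensus`, crux `SoftLayerPropagation` (stmt-AtomisticToContinuum-14233), line `Sketch`.
Worker file for the registered stub `develop_H1R` (signature verbatim from the registered skeleton
`Cruxes/SoftLayerPropagation/Lines/Sketch.lean`; hypothesis `H1R` of `Theorems.develop_rest_of_orderedCaps`).

Proof architecture (all helper files `…H1R*.lean` of this crux item):
* stage A (metric offsets in the frame of the three diagonals of an anchor octahedron through the bond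
  `{u, t}`, unit `nn_t/1.01`): `metric_octahedron_sharp`, the cap lemma `h1r_cap`, the bipyramid-on-cap
  lemma `h1r_bip`, and a second sharp octahedron for the third-generation site;
* stage B (pure real arithmetic): the premises and the negated conclusion are linear in the frame
  coordinates of the observer direction up to the stage-A tolerances; with the frame bounds
  (`h1r_frame`) they are contradictory by degree-two Positivstellensatz certificates, one file per local
  class (`h1r_sb0 … h1r_sb10`);
* stage C (assembly): site lemmas `h1r_site*` (bond graph → windows → stage A → rows → stage B), label
  lemmas `h1r_lab*` (chart of `t` over the integer model → sites), class tables by `decide` and the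
  dispatch `h1r_dispatch_fcc/hcp`, and this file (hard core `u ≠ i`, scope, chart of `t`, labels of
  `u, k`, pattern split).
-/

noncomputable section

namespace Summit.AtomisticToContinuum.Crystallization.Theorems

open Literature.Geometry.DiscreteGeometry

/-- **Registered stub `develop_H1R`** (metric ordered caps): at a site `u` with
`dist (y i) (y u) + (8/3) nn_u ≤ 8 nn_i`, if `u ~ t ~ k`, `u ≁ k`, `u ≠ k`, and, measured from `y i`,
`k` is not farther than `u` by more than `(11/200) nn_u` and `t` is not nearer than `u` by more than
`(3/100) nn_u`, then some bond-neighbour `c` of `u`, nearer to `y i` than `u` by MORE than `(3/100) nn_u`,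
is bonded to `t` or to `k`.  Proof: `u ≠ i` (hard core), the chart of the anchor site `t` and of its
bond-neighbours are in scope, the labels of `u` and `k` in the integer model of that chart are distinct
non-contacts, and the dispatch lemmas `h1r_dispatch_fcc/hcp` (class tables, label lemmas, site lemmas,
the stage-B certificates) conclude. [folklore] -/
theorem develop_H1R : ∀ η : ℝ, 0 < η → η ≤ 1 / 100 → ∀ (N : ℕ) (y : Fin N → EuclideanSpace ℝ (Fin 3)) (i : Fin N), 0 < nearestDist y i → (∀ j : Fin N, dist (y i) (y j) ≤ 8 * nearestDist y i → IsChargeFree η y j) → (∀ j : Fin N, dist (y i) (y j) ≤ 8 * nearestDist y i → ∃ (P : Finset (EuclideanSpace ℝ (Fin 3))) (A : EuclideanSpace ℝ (Fin 3) →ₗᵢ[ℝ] EuclideanSpace ℝ (Fin 3)) (m : EuclideanSpace ℝ (Fin 3) → Fin N), (P = fccKissingPattern ∨ P = hcpKissingPattern) ∧ (∀ p ∈ P, (bondGraph η y).Adj j (m p) ∧ dist (y (m p)) (y j + nearestDist y j • A p) ≤ nearestDist y j / 4) ∧ (∀ p ∈ P, ∀ q ∈ P, m p = m q → p = q) ∧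 (∀ p ∈ P, ∀ q ∈ P, ((bondGraph η y).Adj (m p) (m q) ↔ dist p q = 1)) ∧ (∀ k, (bondGraph η y).Adj j k → ∃ p ∈ P, m p = k)) → ∀ u t k : Fin N, dist (y i) (y u) + 8 / 3 * nearestDist y u ≤ 8 * nearestDist y i → (bondGraph η y).Adj u t → (bondGraph η y).Adj t k → ¬ (bondGraph η y).Adj u k → u ≠ k → dist (y i) (y k) ≤ dist (y i) (y u) + 11 / 200 * nearestDist y u → dist (y i) (y u) ≤ dist (y i) (y t) + 3 / 100 * nearestDist y u → ∃ c : Fin N, (bondGraph η y).Adj u c ∧ dist (y i) (y c) + 3 / 100 * nearestDist y u < dist (y i) (y u) ∧ ((bondGraph η y).Adj c t ∨ (bondGraph η y).Adj c k) := by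
  intro η hη hη' N y i _ hcf hch u t k hsc hut htk hnuk hneuk hP1 hP2
  have hη0 : (0 : ℝ) ≤ η := hη.le
  have hρ : (0 : ℝ) ≤ 1 + η := by linarith
  have hnu0 : 0 ≤ nearestDist y u := nearestDist_nonneg y u
  have hiu : dist (y i) (y u) ≤ 8 * nearestDist y i := by linarith
  have hnu : 0 < nearestDist y u := nearestDist_pos_of_isChargeFree (hcf u hiu)
  -- `u ≠ i`: otherwise `k` would be within `11/200 · nn_u` of `u`
  have hui : u ≠ i := by
    rintro rfl
    have h1 : nearestDist y u ≤ dist (y u) (y k) := nearestDist_le_dist y hneuk.symm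
    rw [dist_self] at hP1
    linarith
  -- scope: the chart of `t` and of its bond-neighbours
  have hdut : dist (y u) (y t) ≤ (1 + η) * nearestDist y u := dist_le_of_adj hρ hut
  have hnt_le : nearestDist y t ≤ (1 + η) * nearestDist y u := nearestDist_le_mul_of_adj hρ hut.symm
  have hnt : 0 < nearestDist y t := by
    have h := nearestDist_le_mul_of_adj hρ hut
    by_contra hc
    push Not at hc
    nlinarith
  have e3 : (1 + η) * nearestDist y u ≤ 101 / 100 * nearestDist y u := mul_le_mul_of_nonneg_right (by linarith) hnu0
  have hit : dist (y i) (y t) ≤ 8 * nearestDist y i := by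
    linarith [dist_triangle (y i) (y u) (y t)]
  obtain ⟨P, A, m, hP, C2, C3, C4, C5⟩ := hch t hit
  have charts : ∀ j : Fin N, (bondGraph η y).Adj t j → ∃ (P : Finset (EuclideanSpace ℝ (Fin 3))) (A : EuclideanSpace ℝ (Fin 3) →ₗᵢ[ℝ] EuclideanSpace ℝ (Fin 3)) (m : EuclideanSpace ℝ (Fin 3) → Fin N), (P = fccKissingPattern ∨ P = hcpKissingPattern) ∧ (∀ p ∈ P, (bondGraph η y).Adj j (m p) ∧ dist (y (m p)) (y j + nearestDist y j • A p) ≤ nearestDist y j / 4) ∧ (∀ p ∈ P, ∀ q ∈ P, m p = m q → p = q) ∧ (∀ p ∈ P, ∀ q ∈ P, ((bondGraph η y).Adj (m p) (m q) ↔ dist p q = 1)) ∧ (∀ l, (bondGraph η y).Adj j l → ∃ p ∈ P, m p = l) := by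
    intro j hj
    apply hch
    have h1 : dist (y t) (y j) ≤ (1 + η) * nearestDist y t := dist_le_of_adj hρ hj
    have e1 : (1 + η) * nearestDist y t ≤ (1 + η) * ((1 + η) * nearestDist y u) := mul_le_mul_of_nonneg_left hnt_le hρ
    have e2 : (1 + η) * ((1 + η) * nearestDist y u) ≤ 10201 / 10000 * nearestDist y u := by nlinarith
    linarith [dist_triangle (y i) (y u) (y j), dist_triangle (y u) (y t) (y j)]
  -- the labels of `u` and `k` in the chart of `t`
  obtain ⟨pu, hpu, mpu⟩ := C5 u hut.symm
  obtain ⟨pk, hpk, mpk⟩ := C5 k htk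
  rcases hP with hPf | hPh
  · have hPS : P = scaledPattern fccInt 2 := hPf
    have hpu' : pu ∈ scaledPattern fccInt 2 := hPS ▸ hpu
    have hpk' : pk ∈ scaledPattern fccInt 2 := hPS ▸ hpk
    obtain ⟨va, hva, hva'⟩ := Finset.mem_image.1 hpu'
    obtain ⟨vk, hvk, hvk'⟩ := Finset.mem_image.1 hpk'
    subst hva' hvk'
    subst mpu mpk
    have hne : va ≠ vk := by
      rintro rfl
      exact hneuk rfl
    have hnc : sqNormInt (va - vk) ≠ (2 : ℕ) := fun h =>
      hnuk ((C4 _ (h1r_memS hPS hva) _ (h1r_memS hPS hvk)).2 ((dist_scaled_intVec_eq_one_iff (by norm_num) va vk).2 h))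
    exact h1r_dispatch_fcc η N y i t P A m va vk hη hη' hnt charts (Or.inl hPf) C2 C3 C4 C5 hPS hva hvk hne hnc hui hP1 hP2
  · have hPS : P = scaledPattern hcpInt 18 := hPh
    have hpu' : pu ∈ scaledPattern hcpInt 18 := hPS ▸ hpu
    have hpk' : pk ∈ scaledPattern hcpInt 18 := hPS ▸ hpk
    obtain ⟨va, hva, hva'⟩ := Finset.mem_image.1 hpu'
    obtain ⟨vk, hvk, hvk'⟩ := Finset.mem_image.1 hpk'
    subst hva' hvk'
    subst mpu mpk
    have hne : va ≠ vk := by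
      rintro rfl
      exact hneuk rfl
    have hnc : sqNormInt (va - vk) ≠ (18 : ℕ) := fun h =>
      hnuk ((C4 _ (h1r_memS hPS hva) _ (h1r_memS hPS hvk)).2 ((dist_scaled_intVec_eq_one_iff (by norm_num) va vk).2 h))
    exact h1r_dispatch_hcp η N y i t P A m va vk hη hη' hnt charts (Or.inr hPh) C2 C3 C4 C5 hPS hva hvk hne hnc hui hP1 hP2

end Summit.AtomisticToContinuum.Crystallization.Theorems

end
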